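import Summits.ABC.ABC.Theorems.DefiniteXiDefiniteRTControlPrimeCyclicCharacterGlobal
import Summits.ABC.ABC.Theorems.IsogenyGlueCongruenceMazurKenkuBoundLevelThirtyTwo
import HarnessLib

/-!
# Crux `DefiniteRTControlPrime` from Takahashi 2.3 alone — part 4/7: the Frobenius end, `deg φ ∣ 16·(n₁₂(p₀)n₁₂(p₁))²`

`frobNorm W p = p¹² + 1 − s₁₂(a_p, p) = #W̃(𝔽_(p¹²))`; Eichler–Shimura at a good odd `p ≠ ℓ` turns the global
dichotomy of part 3 into `ℓ^⌈k/2⌉ ∣ frobNorm W p` (`pow_halfCeil_dvd_frobNorm_of_stableLine`); a cyclic isogeny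
whose degree is divisible by `ℓᵏ` carries a stable line of order `ℓᵏ` (`exists_stableLine_of_isCyclic`); the
2-part of a cyclic degree is `≤ 16` (tree: `isogeny_isCyclic_degree_ne_thirtyTwo`).  Typed output
`cyclicDegreeDvdFrobNormSq : CyclicDegreeDvdFrobNormSq` — for `W₁/ℚ` global minimal and semistable away
from `2`, every cyclic `ℚ`-isogeny `φ` out of `W₁` and any two distinct good odd primes `p₀, p₁`:
`deg φ ∣ 16 · (frobNorm W₁ p₀ · frobNorm W₁ p₁)²` (squaring absorbs `ℓ ∈ {p₀, p₁}`).  No Mazur–Kenku.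
Continues `DefiniteXiDefiniteRTControlPrimeCyclicCharacterGlobal`.

Origin: crux programme of stmt-ABC-11338, kernel certificate `Cruxes/DefiniteRTControlPrime/StubIdeasK2G11CruxFromTakahashi.lean` (stub-ideation k2, gens 2–11; farm `lean check` rc 0, 0 sorries, axioms propext/Classical.choice/Quot.sound), re-packaged verbatim into seven `≤ 400`-line modules by k2 gen 12 (namespaces `…Theorems.DefiniteRTControlPrime.CyclicCharacter` / `.OfTakahashi`; statements and proofs unchanged).

## References

* [Mazur1978] B. Mazur, Rational isogenies of prime degree, Invent. Math. 44 (1978) 129–162, §5 (isogeny characters), Lemma 5.2–5.4.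
* [Serre1972] J.-P. Serre, Propriétés galoisiennes des points d'ordre fini des courbes elliptiques, Invent. Math. 15 (1972), §1.11–1.12, §5.4 Prop. 21.
* [SilvermanATAEC1994] J. H. Silverman, Advanced Topics in the Arithmetic of Elliptic Curves, GTM 151, Thm. V.5.3, Cor. V.5.4, Prop. V.6.1 (Tate curve, Galois action).
* [Takahashi2001] S. Takahashi, Degrees of parametrizations of elliptic curves by Shimura curves, J. Number Theory 90 (2001) 74–88, Thm. 2.3 (p. 79).
* [PastenShimura2024] H. Pasten, Shimura curves and the abc conjecture, J. Number Theory 254 (2024) 214–335 = arXiv:1705.09251, §3 p. 13, §6.4, Lemma 6.8.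
-/

set_option linter.dupNamespace false

namespace Summit.ABC.ABC.Theorems.DefiniteRTControlPrime.CyclicCharacter

open Literature.NumberTheory.EllipticCurves Literature.NumberTheory.EllipticCurves.ModularForms
open Literature.NumberTheory.GaloisRepresentations Literature.NumberTheory.EllipticCurves.TateCurve
open WeierstrassCurve IsDedekindDomain IsDedekindDomain.HeightOneSpectrum NumberField Field
open scoped NumberField NNReal Classical

/-! ## §7 THE FROBENIUS END (gen 11): H5⁻ and G0 PROVED (g9 signatures verbatim) -/

section Frobenius

open Rat.HeightOneSpectrum

/-- `n₁₂(p) = p¹² + 1 − s₁₂(a_p, p) = #Ẽ(𝔽_{p¹²})` (g7/g9 verbatim). -/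
noncomputable def frobNorm (W : WeierstrassCurve ℚ) [W.IsGloballyMinimal] (p : ℕ) : ℤ :=
  (p : ℤ) ^ 12 + 1 - Mazur1978.frobTracePow (W.frobeniusTrace p) p 12

/-- A1 (PROVED, g4–g9 verbatim): a root `t` of `X² − aX + p` in `ℤ/n` (`p` a unit) with `t¹² = 1` OR
`t¹² = p¹²` forces `n ∣ p¹² + 1 − s₁₂(a,p)`. -/
theorem natCast_dvd_frobNorm_of_pow_twelve {n p : ℕ} [NeZero n] (a : ℤ) (hp : IsUnit (p : ZMod n))
    {t : ZMod n} (hroot : t ^ 2 - (a : ZMod n) * t + (p : ZMod n) = 0)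
    (ht : t ^ 12 = 1 ∨ t ^ 12 = (p : ZMod n) ^ 12) :
    (n : ℤ) ∣ (p : ℤ) ^ 12 + 1 - Mazur1978.frobTracePow a p 12 := by
  have hprod' : t * ((a : ZMod n) - t) = (p : ZMod n) := by
    linear_combination (-1 : ZMod n) * hroot
  have hsum : t + ((a : ZMod n) - t) = ((a : ℤ) : ZMod n) := by ring
  have hprod : t * ((a : ZMod n) - t) = (((p : ℕ) : ℤ) : ZMod n) := by
    rw [hprod', Int.cast_natCast]
  have hspec := Mazur1978.frobTracePow_spec hsum hprod 12
  have h12 : ((a : ZMod n) - t) ^ 12 * t ^ 12 = (p : ZMod n) ^ 12 := by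
    rw [← mul_pow, mul_comm, hprod']
  rw [← ZMod.intCast_zmod_eq_zero_iff_dvd]
  push_cast
  rw [← hspec]
  rcases ht with h1 | h2
  · rw [h1, mul_one] at h12
    rw [h1, h12]; ring
  · rw [h2] at h12
    have h3 : ((a : ZMod n) - t) ^ 12 = 1 :=
      (hp.pow 12).mul_right_cancel (h12.trans (one_mul _).symm)
    rw [h2, h3]; ring

/-- **H5⁻ (PROVED, g9 signature verbatim).**  `ℓ^⌈k/2⌉ ∣ n₁₂(p)` at a good `p ∉ {2, ℓ}` for a curve
globally minimal and semistable above the odd prime `ℓ`, carrying a stable cyclic line of order `ℓᵏ`: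
character (`exists_cyclicCharacter_of_addOrderOf`), GLOB⁻ (§6), arithmetic Frobenius over `p`, the
Frobenius congruence (`Mazur1978.cyclicCharacter_sq_sub_frobeniusTrace_mul_add_eq_zero`) cast to level
`ℓ^⌈k/2⌉`, `χ̄(Frob_p) = p`, and A1.  (`hp2` is not used.) -/
theorem pow_halfCeil_dvd_frobNorm_of_stableLine (W₁ : WeierstrassCurve ℚ) [W₁.IsElliptic]
    [W₁.IsGloballyMinimal] (ℓ k : ℕ) [Fact ℓ.Prime] (hℓ2 : ℓ ≠ 2)
    (hss : ∀ v : HeightOneSpectrum (𝓞 ℚ), (ℓ : 𝓞 ℚ) ∈ v.asIdeal → W₁.IsSemistableAt v)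
    {P : geomPoints W₁} (hP : addOrderOf P = ℓ ^ k)
    (hst : ∀ σ : absoluteGaloisGroup ℚ, σ • P ∈ AddSubgroup.zmultiples P)
    (p : ℕ) [Fact p.Prime] (_hp2 : p ≠ 2) (hpℓ : p ≠ ℓ) (hgood : W₁.HasGoodReductionAtPrime p) :
    (ℓ : ℤ) ^ halfCeil k ∣ frobNorm W₁ p := by
  have hℓ : ℓ.Prime := Fact.out
  have hp : p.Prime := Fact.out
  haveI : NeZero (ℓ ^ k) := ⟨pow_ne_zero _ hℓ.ne_zero⟩
  haveI : NeZero (ℓ ^ halfCeil k) := ⟨pow_ne_zero _ hℓ.ne_zero⟩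
  rcases Nat.eq_zero_or_pos k with rfl | hkpos
  · rw [show halfCeil 0 = 0 from rfl, pow_zero]; exact one_dvd _
  have hk : 1 ≤ k := hkpos
  -- the character of the stable line
  obtain ⟨r, hr⟩ := exists_cyclicCharacter_of_addOrderOf W₁ hP hst
  -- the place of `p`, the prime `𝔓` of `ℚ̄` above it cut out by `ℚ̄ ↪ ℚ̄_p`, and a Frobenius there
  set v : HeightOneSpectrum (𝓞 ℚ) := primesEquiv.symm ⟨p, hp⟩ with hvdef
  have hv : (primesEquiv v : ℕ) = p := by rw [hvdef, Equiv.apply_symm_apply]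
  have hgen : natGenerator v = p := hv
  have hpv : (p : 𝓞 ℚ) ∈ v.asIdeal := by
    have h := natCast_natGenerator_mem v
    rwa [hgen] at h
  have h𝔓 := adicCompletionPrime_mem_primesAbove ℚ v
  haveI := h𝔓.1
  obtain ⟨φ, hφ⟩ := HeightOneSpectrum.exists_isArithFrobAt_of_mem_primesAbove_holds (K := ℚ) (v := v) h𝔓
  -- the Frobenius congruence at level `ℓᵏ`, cast to level `ℓ^⌈k/2⌉`
  have hcong := Mazur1978.cyclicCharacter_sq_sub_frobeniusTrace_mul_add_eq_zero W₁ ℓ k p hpℓ hgood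
    hP hr hpv h𝔓 hφ
  set t : ZMod (ℓ ^ halfCeil k) :=
    ((ZMod.unitsMap (pow_halfCeil_dvd ℓ k) (r φ) : (ZMod (ℓ ^ halfCeil k))ˣ) : ZMod (ℓ ^ halfCeil k))
    with htdef
  have htcast : t = ZMod.castHom (pow_halfCeil_dvd ℓ k) (ZMod (ℓ ^ halfCeil k))
      ((r φ : (ZMod (ℓ ^ k))ˣ) : ZMod (ℓ ^ k)) := rfl
  have hroot : t ^ 2 - (W₁.frobeniusTrace p : ZMod (ℓ ^ halfCeil k)) * t
      + (p : ZMod (ℓ ^ halfCeil k)) = 0 := by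
    have h := congrArg (ZMod.castHom (pow_halfCeil_dvd ℓ k) (ZMod (ℓ ^ halfCeil k))) hcong
    rw [map_add, map_sub, map_mul, map_pow, map_intCast, map_natCast, map_zero] at h
    rw [htcast]; exact h
  -- `χ̄(φ) = p`
  have hχφ : (modNCyclotomicCharacter ℚ (ℓ ^ halfCeil k) φ : ZMod (ℓ ^ halfCeil k)) = p := by
    have hnot : ((ℓ ^ halfCeil k : ℕ) : absIntegers (𝓞 ℚ) ℚ) ∉ adicCompletionPrime ℚ v := by
      refine Mazur1978.natCast_not_mem_of_not_mem_asIdeal ?_ h𝔓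
      rw [Nat.cast_pow]
      intro h
      have hℓv : (ℓ : 𝓞 ℚ) ∈ v.asIdeal := v.isPrime.mem_of_pow_mem _ h
      exact hpℓ (hv.symm.trans (primesEquiv_eq_of_natCast_mem v hℓ hℓv))
    rw [modNCyclotomicCharacter_eq_residueCard_of_isArithFrobAt h𝔓 hnot hφ,
      residueCard_eq_of_natCast_mem_rat hp hpv]
  -- GLOB⁻: `t¹² = 1` or `t¹² = p¹²`
  have ht12 : t ^ 12 = 1 ∨ t ^ 12 = (p : ZMod (ℓ ^ halfCeil k)) ^ 12 := by
    rcases unitsMap_cyclicCharacter_pow_twelve_dichotomy W₁ ℓ k hℓ2 hk hss hP hr with hA | hB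
    · left
      have h := congrArg Units.val (hA φ)
      rw [Units.val_pow_eq_pow_val, Units.val_one] at h
      exact h
    · right
      have h := congrArg Units.val (hB φ)
      rw [Units.val_pow_eq_pow_val, Units.val_pow_eq_pow_val, hχφ] at h
      exact h
  -- `p` is a unit modulo `ℓ^⌈k/2⌉`; conclude by A1
  have hcop : Nat.Coprime p (ℓ ^ halfCeil k) :=
    Nat.Coprime.pow_right _ ((Nat.coprime_primes hp hℓ).mpr hpℓ)
  have hpunit : IsUnit (p : ZMod (ℓ ^ halfCeil k)) := by
    rw [← ZMod.coe_unitOfCoprime p hcop]; exact Units.isUnit _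
  have hA1 := natCast_dvd_frobNorm_of_pow_twelve (n := ℓ ^ halfCeil k) (W₁.frobeniusTrace p) hpunit
    hroot ht12
  rw [frobNorm]
  exact_mod_cast hA1

/-- **G0 (PROVED, g9 signature verbatim)**: the `ℓ`-primary part of a cyclic stable kernel contains a
stable cyclic line of order `ℓᵏ` whenever `ℓᵏ ∣ deg` (`Isogeny.exists_isCyclic_degree_eq_of_dvd`,
`IsAddCyclic.exists_ofOrder_eq_natCard`). -/
theorem exists_stableLine_of_isCyclic {W₁ W₂ : WeierstrassCurve ℚ} [W₁.IsElliptic] [W₂.IsElliptic]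
    (φ : Isogeny W₁ W₂) (hφ : φ.IsCyclic) (ℓ k : ℕ) [Fact ℓ.Prime] (hdiv : ℓ ^ k ∣ φ.degree) :
    ∃ P : geomPoints W₁, addOrderOf P = ℓ ^ k ∧
      ∀ σ : absoluteGaloisGroup ℚ, σ • P ∈ AddSubgroup.zmultiples P := by
  obtain ⟨W'', hW'', ψ, hψ, hq, -⟩ := φ.exists_isCyclic_degree_eq_of_dvd hφ hdiv
  haveI : IsAddCyclic ψ.toAddMonoidHom.ker := hψ
  obtain ⟨g, hg⟩ := IsAddCyclic.exists_ofOrder_eq_natCard (α := ψ.toAddMonoidHom.ker)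
  have hordP : addOrderOf (g : W₁.geomPoints) = ℓ ^ k := by
    rw [AddSubgroup.addOrderOf_coe, hg]
    exact hq
  have hgen : AddSubgroup.zmultiples (g : W₁.geomPoints) = ψ.toAddMonoidHom.ker := by
    apply AddSubgroup.eq_of_le_of_card_ge (AddSubgroup.zmultiples_le.mpr g.2)
    rw [Nat.card_zmultiples, hordP]
    exact hq.le
  have hg0 : ψ (g : W₁.geomPoints) = 0 := (AddMonoidHom.mem_ker).mp g.2
  refine ⟨g, hordP, fun σ => ?_⟩
  rw [hgen, AddMonoidHom.mem_ker, Isogeny.coe_toAddMonoidHom, ψ.map_smul, hg0, smul_zero]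

end Frobenius


/-! ## §8 THE TYPED OUTPUT OF THE LINE (gen 11): C0² `CyclicDegreeDvdFrobNormSq` PROVED -/

section Output

open Rat.HeightOneSpectrum

/-- **C0² (g7/g9 verbatim; the typed Mazur–Kenku-free output of the line).** -/
def CyclicDegreeDvdFrobNormSq : Prop :=
  ∀ (W₁ W₂ : WeierstrassCurve ℚ) [W₁.IsElliptic] [W₂.IsElliptic] [W₁.IsGloballyMinimal],
    (∀ v : HeightOneSpectrum (𝓞 ℚ), (2 : 𝓞 ℚ) ∉ v.asIdeal → W₁.IsSemistableAt v) →
    ∀ (φ : Isogeny W₁ W₂), φ.IsCyclic →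
    ∀ (p₀ p₁ : ℕ) [Fact p₀.Prime] [Fact p₁.Prime], p₀ ≠ 2 → p₁ ≠ 2 → p₀ ≠ p₁ →
      W₁.HasGoodReductionAtPrime p₀ → W₁.HasGoodReductionAtPrime p₁ →
      φ.degree ∣ 16 * ((frobNorm W₁ p₀ * frobNorm W₁ p₁).natAbs) ^ 2

/-- `k ≤ 2⌈k/2⌉`. -/
theorem le_two_mul_halfCeil (k : ℕ) : k ≤ 2 * halfCeil k := by unfold halfCeil; omega

/-- C1 (PROVED, g3 verbatim): half exponents at every prime give `d ∣ n²`. -/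
theorem dvd_sq_of_forall_pow_halfCeil_dvd {d n : ℕ} (hd : 0 < d) (hn : 0 < n)
    (h : ∀ ℓ : ℕ, ℓ.Prime → ℓ ∣ d → ℓ ^ halfCeil (d.factorization ℓ) ∣ n) : d ∣ n ^ 2 := by
  rw [← Nat.factorization_le_iff_dvd hd.ne' (pow_pos hn 2).ne', Nat.factorization_pow]
  refine Finsupp.le_def.mpr fun ℓ => ?_
  rw [Finsupp.smul_apply, smul_eq_mul]
  by_cases hℓ : ℓ.Prime
  · by_cases hℓd : ℓ ∣ d
    · have h2 : halfCeil (d.factorization ℓ) ≤ n.factorization ℓ :=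
        (hℓ.pow_dvd_iff_le_factorization hn.ne').mp (h ℓ hℓ hℓd)
      have h3 := le_two_mul_halfCeil (d.factorization ℓ)
      omega
    · rw [Nat.factorization_eq_zero_of_not_dvd hℓd]; exact Nat.zero_le _
  · rw [Nat.factorization_eq_zero_of_not_prime d hℓ]; exact Nat.zero_le _

/-- **C0² PROVED.**  Odd `ℓ ∣ deg φ` with `ℓᵉ ‖ deg φ`: G0 gives a stable line of order `ℓᵉ`; `W₁` is
semistable above `ℓ` (`ℓ ≠ 2`); H5⁻ at a `pᵢ ≠ ℓ` gives `ℓ^⌈e/2⌉ ∣ n₁₂(pᵢ) ∣ n₁₂(p₀)n₁₂(p₁)`; so the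
odd part of `deg φ` divides `(n₁₂(p₀)n₁₂(p₁))²` (C1).  `2`-part: `32 ∤` cyclic degrees
(`isogeny_isCyclic_degree_ne_thirtyTwo` + `Isogeny.exists_isCyclic_degree_eq_of_dvd`), so it divides `16`. -/
theorem cyclicDegreeDvdFrobNormSq : CyclicDegreeDvdFrobNormSq := by
  intro W₁ W₂ _ _ _ hss2 φ hφ p₀ p₁ _ _ hp₀2 hp₁2 hp01 hgood₀ hgood₁
  have hp₀ : p₀.Prime := Fact.out
  have hp₁ : p₁.Prime := Fact.out
  set n : ℕ := (frobNorm W₁ p₀ * frobNorm W₁ p₁).natAbs with hn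
  set d : ℕ := φ.degree with hd
  have hdpos : 0 < d := φ.degree_pos
  rcases Nat.eq_zero_or_pos n with hn0 | hnpos
  · rw [hn0]; simp
  -- semistability above every odd prime
  have hssodd : ∀ ℓ : ℕ, ℓ.Prime → ℓ ≠ 2 → ∀ v : HeightOneSpectrum (𝓞 ℚ),
      (ℓ : 𝓞 ℚ) ∈ v.asIdeal → W₁.IsSemistableAt v := by
    intro ℓ hℓ hℓ2 v hℓv
    refine hss2 v fun h2 => hℓ2 ?_
    have h2' : ((2 : ℕ) : 𝓞 ℚ) ∈ v.asIdeal := by exact_mod_cast h2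
    exact (primesEquiv_eq_of_natCast_mem v hℓ hℓv).symm.trans
      (primesEquiv_eq_of_natCast_mem v Nat.prime_two h2')
  -- every odd prime: `ℓ^⌈e/2⌉ ∣ n`
  have hodd : ∀ ℓ : ℕ, ℓ.Prime → ℓ ≠ 2 → ℓ ^ halfCeil (d.factorization ℓ) ∣ n := by
    intro ℓ hℓ hℓ2
    haveI : Fact ℓ.Prime := ⟨hℓ⟩
    have hdiv : ℓ ^ d.factorization ℓ ∣ φ.degree := Nat.ordProj_dvd d ℓ
    obtain ⟨P, hP, hst⟩ := exists_stableLine_of_isCyclic φ hφ ℓ (d.factorization ℓ) hdiv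
    have key : ∀ (p : ℕ) [Fact p.Prime], p ≠ 2 → p ≠ ℓ → W₁.HasGoodReductionAtPrime p →
        (ℓ : ℤ) ^ halfCeil (d.factorization ℓ) ∣ frobNorm W₁ p :=
      fun p _ hp2 hpℓ hgood =>
        pow_halfCeil_dvd_frobNorm_of_stableLine W₁ ℓ _ hℓ2 (hssodd ℓ hℓ hℓ2) hP hst p hp2 hpℓ hgood
    have hZ : (ℓ : ℤ) ^ halfCeil (d.factorization ℓ) ∣ frobNorm W₁ p₀ * frobNorm W₁ p₁ := by
      by_cases h0 : p₀ = ℓ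
      · have h1 : p₁ ≠ ℓ := fun h => hp01 (h0.trans h.symm)
        exact Dvd.dvd.mul_left (key p₁ hp₁2 h1 hgood₁) _
      · exact Dvd.dvd.mul_right (key p₀ hp₀2 h0 hgood₀) _
    have hN := Int.natAbs_dvd_natAbs.mpr hZ
    rwa [Int.natAbs_pow, Int.natAbs_natCast] at hN
  -- the `2`-part divides `16`
  have h2part : 2 ^ d.factorization 2 ∣ 16 := by
    have hlt : d.factorization 2 < 5 := by
      by_contra h5
      push Not at h5
      have h32 : 2 ^ 5 ∣ φ.degree := (pow_dvd_pow 2 h5).trans (Nat.ordProj_dvd d 2)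
      obtain ⟨V, hV, ψ, hψ, hdeg, -⟩ := φ.exists_isCyclic_degree_eq_of_dvd hφ h32
      exact Summit.ABC.ABC.Theorems.isogeny_isCyclic_degree_ne_thirtyTwo ψ hψ
        (hdeg.trans (by norm_num))
    calc 2 ^ d.factorization 2 ∣ 2 ^ 4 := pow_dvd_pow 2 (by omega)
      _ = 16 := by norm_num
  -- the odd part divides `n²`
  have hoddpart : ordCompl[2] d ∣ n ^ 2 := by
    refine dvd_sq_of_forall_pow_halfCeil_dvd (Nat.ordCompl_pos 2 hdpos.ne') hnpos
      fun ℓ hℓ hℓd => ?_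
    have hℓ2 : ℓ ≠ 2 := by
      rintro rfl
      exact Nat.not_dvd_ordCompl Nat.prime_two hdpos.ne' hℓd
    rw [Nat.factorization_ordCompl, Finsupp.erase_ne hℓ2]
    exact hodd ℓ hℓ hℓ2
  calc φ.degree = ordProj[2] d * ordCompl[2] d := (Nat.ordProj_mul_ordCompl_eq_self d 2).symm
    _ ∣ 16 * n ^ 2 := mul_dvd_mul h2part hoddpart

end Output

end Summit.ABC.ABC.Theorems.DefiniteRTControlPrime.CyclicCharacter
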